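import Summits.RiemannHypothesis.RiemannHypothesis.Theorems.PfPersistenceRatioFarGuarded
import Summits.RiemannHypothesis.RiemannHypothesis.Theorems.PfPersistenceHeightLocality
import Summits.RiemannHypothesis.RiemannHypothesis.Theorems.PfPersistenceLocalityBarrier
import HarnessLib

/-!
# PF persistence — leaf G1.21b `(Z)`-cell: CEILINGS ARE FATAL, FLOORS ARE NONLOCAL, and the YOSHIDA BAND
(pub-rhpf barrier-prover gen 5, file 14)

**HONEST FRAMING. Long-odds mechanism / rigidity campaign; no RH claims.** Everything here is RH-free bookkeeping
about the sign-blind RATIO readers of the `(Z)`-cell (`gaugeRatioAt τ`, `modulusRatioAt κ`); nothing bears on RH.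

Files 11–13: a window FLOOR is necessary (`PfPersistenceRatioShortWindowSettled`); the live remainder is the
FAR-GUARDED class (`PfPersistenceRatioFarGuarded`). Here: the CEILING side, and the split at Yoshida's cut `(log 3)/2`.
* §1 BAND-GUARDED classes `GaugeRatioClassBand a_min a_max τ` (floor AND ceiling); the far class is the intersection
  of its bands (`mem_gaugeRatioClassFar_iff_forall_band`) and splits at any cut (`…_iff_band_and_tail`).
* §3 **CEILINGS ARE FATAL (W1, RH-free):** a band class is decided below height `a_max`
  (`determinedOn_below_gaugeRatioClassBand`), hence NEVER separates `ζ` on any domain `⊇ arithDialSpace`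
  (`not_separates_gaugeRatioClassBand`, the tree's `not_separates_of_determinedOn_below_arith`); it cannot even tell
  `ζ` from its dials at `p > e^{2 a_max}` (`dial_mem_gaugeRatioClassBand_iff`).
* §4 **FLOOR-ONLY CLASSES ARE NONLOCAL AT EVERY HEIGHT** (`nonlocalAtEveryHeight_gaugeRatioClassFar`; exit witness
  zero datum vs. identity at one far window): the far classes satisfy clause (2) of `G1` — outside W1's class.
* §5 **THE YOSHIDA BAND `a ≤ (log 3)/2` (RH-free):** there `0 < ε₁(ζ(a, N))` for every `N`
  (`zeta_bottomRayleigh_pos_of_le_log_three_half`, from the tree's first rung), so the deep-negative failure mode is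
  ABSENT and membership is the RELATIVE-GAP inequality `(1 + τ) ε₁ ≤ τ ε₂` (resp. `ε₁ ≤ κ ε₂`)
  (`zeta_mem_gaugeRatioAt_iff_of_le_log_three_half`); the far premise splits into a zero-free relative-gap statement
  on the band `[a_min, (log 3)/2]` and the tail `a > (log 3)/2` (`zeta_mem_gaugeRatioClassFar_iff_yoshida_split`).
* §6 the served window `a = 3/10` is in the band and PRIME-FREE (`e^{0.6} < 2`; `datumOf_apply_three_tenths_eq_zeta`).
-/

set_option linter.dupNamespace false  -- the mandated namespace repeats `RiemannHypothesis`

noncomputable section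

open Real Set Matrix

open Literature.NumberTheory.LFunctions

namespace Summit.RiemannHypothesis.RiemannHypothesis.Theorems.PfPersistence

/-! ## §1 Band-guarded ratio classes (floor and ceiling) -/

/-- the BAND-GUARDED gauge-ratio class: the gauge conjunct at every window with `a_min ≤ a ≤ a_max`, `0 < N`.
[folklore] -/
def GaugeRatioClassBand (amin amax τ : ℝ) : Set Datum :=
  {d | ∀ win : Window, amin ≤ win.a → win.a ≤ amax → 0 < win.N → d ∈ gaugeRatioAt τ win}

/-- the BAND-GUARDED modulus-ratio class. [folklore] -/
def ModulusRatioClassBand (amin amax κ : ℝ) : Set Datum :=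
  {d | ∀ win : Window, amin ≤ win.a → win.a ≤ amax → 0 < win.N → d ∈ modulusRatioAt κ win}

/-- PROVED: far ⊆ band. [folklore] -/
theorem gaugeRatioClassFar_subset_band (amin amax τ : ℝ) :
    GaugeRatioClassFar amin τ ⊆ GaugeRatioClassBand amin amax τ := fun _ h win h₁ _ hN => h win h₁ hN

/-- PROVED: far ⊆ band (modulus). [folklore] -/
theorem modulusRatioClassFar_subset_band (amin amax κ : ℝ) :
    ModulusRatioClassFar amin κ ⊆ ModulusRatioClassBand amin amax κ := fun _ h win h₁ _ hN => h win h₁ hN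

/-- PROVED: the far class is the intersection of its bands. [folklore] -/
theorem mem_gaugeRatioClassFar_iff_forall_band {d : Datum} {amin τ : ℝ} :
    d ∈ GaugeRatioClassFar amin τ ↔ ∀ amax : ℝ, d ∈ GaugeRatioClassBand amin amax τ :=
  ⟨fun h amax => gaugeRatioClassFar_subset_band amin amax τ h, fun h win h₁ hN => h win.a win h₁ le_rfl hN⟩

/-- PROVED: bands are antitone in the band. [folklore] -/
theorem gaugeRatioClassBand_mono {amin amin' amax amax' : ℝ} (h₁ : amin ≤ amin') (h₂ : amax' ≤ amax) (τ : ℝ) :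
    GaugeRatioClassBand amin amax τ ⊆ GaugeRatioClassBand amin' amax' τ :=
  fun _ h win hw₁ hw₂ hN => h win (h₁.trans hw₁) (hw₂.trans h₂) hN

/-- PROVED: the far premise splits at any cut `c` into the band `[a_min, c]` and the tail `a > c`. [folklore] -/
theorem mem_gaugeRatioClassFar_iff_band_and_tail {d : Datum} {amin τ : ℝ} (c : ℝ) :
    d ∈ GaugeRatioClassFar amin τ ↔ d ∈ GaugeRatioClassBand amin c τ ∧
      ∀ win : Window, c < win.a → amin ≤ win.a → 0 < win.N → d ∈ gaugeRatioAt τ win := by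
  refine ⟨fun h => ⟨gaugeRatioClassFar_subset_band amin c τ h, fun win _ h₁ hN => h win h₁ hN⟩,
    fun h win h₁ hN => ?_⟩
  by_cases hc : win.a ≤ c
  · exact h.1 win h₁ hc hN
  · exact h.2 win (not_le.1 hc) h₁ hN

/-- PROVED: the far premise splits at any cut (modulus). [folklore] -/
theorem mem_modulusRatioClassFar_iff_band_and_tail {d : Datum} {amin κ : ℝ} (c : ℝ) :
    d ∈ ModulusRatioClassFar amin κ ↔ d ∈ ModulusRatioClassBand amin c κ ∧
      ∀ win : Window, c < win.a → amin ≤ win.a → 0 < win.N → d ∈ modulusRatioAt κ win := by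
  refine ⟨fun h => ⟨modulusRatioClassFar_subset_band amin c κ h, fun win _ h₁ hN => h win h₁ hN⟩,
    fun h win h₁ hN => ?_⟩
  by_cases hc : win.a ≤ c
  · exact h.1 win h₁ hc hN
  · exact h.2 win (not_le.1 hc) h₁ hN

/-! ## §2 Membership at a window depends only on the matrix there -/

/-- PROVED: congruence of the gauge conjunct. [folklore] -/
theorem mem_gaugeRatioAt_congr {d d' : Datum} {win : Window} (h : d win = d' win) (τ : ℝ) :
    d ∈ gaugeRatioAt τ win ↔ d' ∈ gaugeRatioAt τ win := by
  simp only [gaugeRatioAt, bottomGapGauge, Set.mem_setOf_eq, h]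

/-- PROVED: congruence of the modulus conjunct. [folklore] -/
theorem mem_modulusRatioAt_congr {d d' : Datum} {win : Window} (h : d win = d' win) (κ : ℝ) :
    d ∈ modulusRatioAt κ win ↔ d' ∈ modulusRatioAt κ win := by
  simp only [modulusRatioAt, Set.mem_setOf_eq, h]

/-! ## §3 CEILINGS ARE FATAL: band classes are decided below `a_max` (wall W1, RH-free) -/

/-- **PROVED: a band-guarded gauge class is decided below height `a_max`.** [folklore] -/
theorem determinedOn_below_gaugeRatioClassBand (amin amax τ : ℝ) :
    DeterminedOn (GaugeRatioClassBand amin amax τ) (below amax) := fun _ _ h =>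
  ⟨fun hd win h₁ h₂ hN => (mem_gaugeRatioAt_congr (h win h₂) τ).1 (hd win h₁ h₂ hN),
    fun hd win h₁ h₂ hN => (mem_gaugeRatioAt_congr (h win h₂) τ).2 (hd win h₁ h₂ hN)⟩

/-- PROVED: a band-guarded modulus class is decided below height `a_max`. [folklore] -/
theorem determinedOn_below_modulusRatioClassBand (amin amax κ : ℝ) :
    DeterminedOn (ModulusRatioClassBand amin amax κ) (below amax) := fun _ _ h =>
  ⟨fun hd win h₁ h₂ hN => (mem_modulusRatioAt_congr (h win h₂) κ).1 (hd win h₁ h₂ hN),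
    fun hd win h₁ h₂ hN => (mem_modulusRatioAt_congr (h win h₂) κ).2 (hd win h₁ h₂ hN)⟩

/-- **PROVED — WALL W1 (RH-free): a band-guarded gauge class NEVER separates `ζ` from the detectably negative data
on any domain `D ⊇ arithDialSpace`**, whatever `a_min`, `a_max`, `τ`. [folklore] -/
theorem not_separates_gaugeRatioClassBand {D : Set Datum} (hD : arithDialSpace ⊆ D) (amin amax τ : ℝ) :
    ¬ Separates (GaugeRatioClassBand amin amax τ) D zetaDatum :=
  not_separates_of_determinedOn_below_arith hD (determinedOn_below_gaugeRatioClassBand amin amax τ)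

/-- PROVED — WALL W1 (RH-free), modulus form, every `κ`. [folklore] -/
theorem not_separates_modulusRatioClassBand {D : Set Datum} (hD : arithDialSpace ⊆ D) (amin amax κ : ℝ) :
    ¬ Separates (ModulusRatioClassBand amin amax κ) D zetaDatum :=
  not_separates_of_determinedOn_below_arith hD (determinedOn_below_modulusRatioClassBand amin amax κ)

/-- PROVED: band classes FAIL clause (2) of `G1` (they are local at height `a_max`). [folklore] -/
theorem not_nonlocalAtEveryHeight_gaugeRatioClassBand (amin amax τ : ℝ) :
    ¬ NonlocalAtEveryHeight (GaugeRatioClassBand amin amax τ) :=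
  not_nonlocalAtEveryHeight_of_determinedOn_below (determinedOn_below_gaugeRatioClassBand amin amax τ)

/-- PROVED (locality): a dial at `p > e^{2a}` leaves `ζ`'s block at the window unchanged. [folklore] -/
theorem datumOf_dial_apply_eq_zeta_of_exp_lt {p : ℕ} {win : Window} (hp : Real.exp (2 * win.a) < p) (K : ℝ) :
    datumOf (dial p K zetaWeights) win = zetaDatum win :=
  evenBlock_dial_of_not_mem hp K zetaWeights

/-- **PROVED: a band class cannot tell `ζ` from ANY of its dials at `p > e^{2 a_max}`** (any amplitude). [folklore] -/
theorem dial_mem_gaugeRatioClassBand_iff {p : ℕ} {amax : ℝ} (hp : Real.exp (2 * amax) < p) (amin τ K : ℝ) :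
    datumOf (dial p K zetaWeights) ∈ GaugeRatioClassBand amin amax τ ↔
      zetaDatum ∈ GaugeRatioClassBand amin amax τ :=
  determinedOn_below_gaugeRatioClassBand amin amax τ _ _ fun win hwin =>
    datumOf_dial_apply_eq_zeta_of_exp_lt
      (lt_of_le_of_lt (Real.exp_le_exp.2 (by have : win.a ≤ amax := hwin; linarith)) hp) K

/-! ## §4 FLOOR-ONLY CLASSES ARE NONLOCAL AT EVERY HEIGHT (outside W1's technique class) -/

/-- PROVED: `ε₁(0) = 0`. [folklore] -/
theorem bottomRayleigh_zero_matrix (n : ℕ) : bottomRayleigh (0 : Matrix (Fin (n + 1)) (Fin (n + 1)) ℝ) = 0 := by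
  have hne : (fun _ : Fin (n + 1) => (1 : ℝ)) ≠ 0 := fun h => one_ne_zero (congr_fun h 0)
  exact le_antisymm ((bottomRayleigh_le_rayleigh _ hne).trans (by simp))
    (le_bottomRayleigh_of_forall _ fun v _ => by simp)

/-- PROVED: `ε₁(1) = 1`. [folklore] -/
theorem bottomRayleigh_one_matrix (n : ℕ) : bottomRayleigh (1 : Matrix (Fin (n + 1)) (Fin (n + 1)) ℝ) = 1 := by
  have hq : ∀ v : Fin (n + 1) → ℝ, v ≠ 0 → v ⬝ᵥ ((1 : Matrix (Fin (n + 1)) (Fin (n + 1)) ℝ) *ᵥ v) / (v ⬝ᵥ v) = 1 :=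
    fun v hv => by
      rw [Matrix.one_mulVec, div_self (fun h => hv (dotProduct_self_eq_zero.1 h))]
  have hne : (fun _ : Fin (n + 1) => (1 : ℝ)) ≠ 0 := fun h => one_ne_zero (congr_fun h 0)
  exact le_antisymm ((bottomRayleigh_le_rayleigh _ hne).trans (hq _ hne).le)
    (le_bottomRayleigh_of_forall _ fun v hv => (hq v hv).ge)

/-- PROVED: a form bounded by `B` everywhere has `ε₂ ≤ B` (dimension `≥ 2`). [folklore] -/
theorem secondRayleigh_le_of_form_le {n : ℕ} (hn : 0 < n) {M : Matrix (Fin (n + 1)) (Fin (n + 1)) ℝ} {B : ℝ}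
    (hB : ∀ v : Fin (n + 1) → ℝ, v ⬝ᵥ (M *ᵥ v) ≤ B * (v ⬝ᵥ v)) : secondRayleigh M ≤ B := by
  let i₁ : Fin (n + 1) := ⟨1, by omega⟩
  have h10 : i₁ ≠ 0 := by simp [i₁, Fin.ext_iff]
  let x : Fin (n + 1) → ℝ := Pi.single 0 1
  let y : Fin (n + 1) → ℝ := Pi.single i₁ 1
  have hx : x ≠ 0 := fun h => by
    have := congr_fun h 0
    simp [x] at this
  have hy : y ≠ 0 := fun h => by
    have := congr_fun h i₁
    simp [y] at this
  have hxy : y ⬝ᵥ x = 0 := by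
    simp only [x, y, single_dotProduct, one_mul]
    exact Pi.single_eq_of_ne h10 _
  exact secondRayleigh_le_of_plane hx hy hxy fun α β => hB _

/-- PROVED: `ε₂(0) = 0` (dimension `≥ 2`). [folklore] -/
theorem secondRayleigh_zero_matrix {n : ℕ} (hn : 0 < n) :
    secondRayleigh (0 : Matrix (Fin (n + 1)) (Fin (n + 1)) ℝ) = 0 :=
  le_antisymm (secondRayleigh_le_of_form_le hn fun v => by simp)
    (by simpa [bottomRayleigh_zero_matrix] using bottomRayleigh_le_secondRayleigh hn (0 : Matrix _ _ ℝ))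

/-- PROVED: `ε₂(1) = 1` (dimension `≥ 2`). [folklore] -/
theorem secondRayleigh_one_matrix {n : ℕ} (hn : 0 < n) :
    secondRayleigh (1 : Matrix (Fin (n + 1)) (Fin (n + 1)) ℝ) = 1 :=
  le_antisymm (secondRayleigh_le_of_form_le hn fun v => by simp)
    (by simpa [bottomRayleigh_one_matrix] using bottomRayleigh_le_secondRayleigh hn (1 : Matrix _ _ ℝ))

/-- PROVED: the ZERO DATUM is accepted by the gauge conjunct at every window of positive `N`, every `τ`. [folklore] -/
theorem zero_mem_gaugeRatioAt {win : Window} (hN : 0 < win.N) (τ : ℝ) : (0 : Datum) ∈ gaugeRatioAt τ win := by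
  show |bottomRayleigh ((0 : Datum) win)| ≤ τ * (secondRayleigh ((0 : Datum) win) - bottomRayleigh ((0 : Datum) win))
  simp [bottomRayleigh_zero_matrix, secondRayleigh_zero_matrix hN]

/-- PROVED: the zero datum is accepted by the modulus conjunct at every window of positive `N`, every `κ`. [folklore] -/
theorem zero_mem_modulusRatioAt {win : Window} (hN : 0 < win.N) (κ : ℝ) : (0 : Datum) ∈ modulusRatioAt κ win := by
  show |bottomRayleigh ((0 : Datum) win)| ≤ κ * |secondRayleigh ((0 : Datum) win)|
  simp [bottomRayleigh_zero_matrix, secondRayleigh_zero_matrix hN]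

/-- PROVED: the zero datum lies in every far-guarded gauge class. [folklore] -/
theorem zero_mem_gaugeRatioClassFar (amin τ : ℝ) : (0 : Datum) ∈ GaugeRatioClassFar amin τ :=
  fun _ _ hN => zero_mem_gaugeRatioAt hN τ

/-- PROVED: the zero datum lies in every far-guarded modulus class. [folklore] -/
theorem zero_mem_modulusRatioClassFar (amin κ : ℝ) : (0 : Datum) ∈ ModulusRatioClassFar amin κ :=
  fun _ _ hN => zero_mem_modulusRatioAt hN κ

/-- PROVED: a datum equal to the IDENTITY at a window of positive `N` is rejected there by every gauge conjunct.
[folklore] -/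
theorem not_mem_gaugeRatioAt_of_apply_eq_one {d : Datum} {win : Window} (hN : 0 < win.N) (h1 : d win = 1) (τ : ℝ) :
    d ∉ gaugeRatioAt τ win := by
  intro h
  have h' : |bottomRayleigh (d win)| ≤ τ * (secondRayleigh (d win) - bottomRayleigh (d win)) := h
  rw [h1, bottomRayleigh_one_matrix, secondRayleigh_one_matrix hN] at h'
  norm_num at h'

/-- PROVED: … and by every modulus conjunct with `κ < 1`. [folklore] -/
theorem not_mem_modulusRatioAt_of_apply_eq_one {d : Datum} {win : Window} (hN : 0 < win.N) (h1 : d win = 1)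
    {κ : ℝ} (hκ : κ < 1) : d ∉ modulusRatioAt κ win := by
  intro h
  have h' : |bottomRayleigh (d win)| ≤ κ * |secondRayleigh (d win)| := h
  rw [h1, bottomRayleigh_one_matrix, secondRayleigh_one_matrix hN] at h'
  norm_num at h'
  linarith

/-- **PROVED: a far-guarded gauge class is NOT decided below any height `A`** (exit witness: the zero datum is a
member; the datum equal to it except for the identity at one window of height `> max(A, a_min, 0)` is not).
[folklore] -/
theorem not_determinedOn_below_gaugeRatioClassFar (amin τ A : ℝ) :
    ¬ DeterminedOn (GaugeRatioClassFar amin τ) (below A) := by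
  classical
  have hm₁ : A ≤ max (max amin A) 0 := (le_max_right _ _).trans (le_max_left _ _)
  have hm₂ : amin ≤ max (max amin A) 0 := (le_max_left _ _).trans (le_max_left _ _)
  have hm₃ : (0 : ℝ) ≤ max (max amin A) 0 := le_max_right _ _
  let win₀ : Window := ⟨max (max amin A) 0 + 1, 1, by linarith⟩
  let d : Datum := fun win => if win = win₀ then 1 else 0
  have hd₀ : d win₀ = 1 := by simp [d]
  have hd : d ∉ GaugeRatioClassFar amin τ := fun h =>
    not_mem_gaugeRatioAt_of_apply_eq_one (win := win₀) Nat.one_pos hd₀ τ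
      (h win₀ (show amin ≤ max (max amin A) 0 + 1 by linarith) Nat.one_pos)
  have hwin₀ : win₀ ∉ below A := fun hle => by
    have hle' : max (max amin A) 0 + 1 ≤ A := hle
    linarith
  exact not_determinedOn_of_exit (zero_mem_gaugeRatioClassFar amin τ) hd hwin₀ fun win hne => by simp [d, hne]

/-- PROVED: a far-guarded modulus class (`κ < 1`) is not decided below any height. [folklore] -/
theorem not_determinedOn_below_modulusRatioClassFar (amin : ℝ) {κ : ℝ} (hκ : κ < 1) (A : ℝ) :
    ¬ DeterminedOn (ModulusRatioClassFar amin κ) (below A) := by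
  classical
  have hm₁ : A ≤ max (max amin A) 0 := (le_max_right _ _).trans (le_max_left _ _)
  have hm₂ : amin ≤ max (max amin A) 0 := (le_max_left _ _).trans (le_max_left _ _)
  have hm₃ : (0 : ℝ) ≤ max (max amin A) 0 := le_max_right _ _
  let win₀ : Window := ⟨max (max amin A) 0 + 1, 1, by linarith⟩
  let d : Datum := fun win => if win = win₀ then 1 else 0
  have hd₀ : d win₀ = 1 := by simp [d]
  have hd : d ∉ ModulusRatioClassFar amin κ := fun h =>
    not_mem_modulusRatioAt_of_apply_eq_one (win := win₀) Nat.one_pos hd₀ hκ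
      (h win₀ (show amin ≤ max (max amin A) 0 + 1 by linarith) Nat.one_pos)
  have hwin₀ : win₀ ∉ below A := fun hle => by
    have hle' : max (max amin A) 0 + 1 ≤ A := hle
    linarith
  exact not_determinedOn_of_exit (zero_mem_modulusRatioClassFar amin κ) hd hwin₀ fun win hne => by simp [d, hne]

/-- **PROVED: every far-guarded gauge class is NONLOCAL AT EVERY HEIGHT** — it satisfies clause (2) of `G1`; the
bounded-height wall W1 does not quantify over it. [folklore] -/
theorem nonlocalAtEveryHeight_gaugeRatioClassFar (amin τ : ℝ) : NonlocalAtEveryHeight (GaugeRatioClassFar amin τ) :=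
  fun A => not_determinedOn_below_gaugeRatioClassFar amin τ A

/-- PROVED: every far-guarded modulus class with `κ < 1` is nonlocal at every height. [folklore] -/
theorem nonlocalAtEveryHeight_modulusRatioClassFar (amin : ℝ) {κ : ℝ} (hκ : κ < 1) :
    NonlocalAtEveryHeight (ModulusRatioClassFar amin κ) :=
  fun A => not_determinedOn_below_modulusRatioClassFar amin hκ A

/-- PROVED: so are the ∀-window guarded classes (`a_min ≤ 0`). [folklore] -/
theorem nonlocalAtEveryHeight_gaugeRatioClassPos (τ : ℝ) : NonlocalAtEveryHeight (GaugeRatioClassPos τ) := by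
  rw [← gaugeRatioClassFar_eq_pos_of_nonpos le_rfl τ]
  exact nonlocalAtEveryHeight_gaugeRatioClassFar 0 τ

/-- PROVED: and the ∀-window guarded modulus classes, `κ < 1`. [folklore] -/
theorem nonlocalAtEveryHeight_modulusRatioClassPos {κ : ℝ} (hκ : κ < 1) :
    NonlocalAtEveryHeight (ModulusRatioClassPos κ) := by
  rw [← modulusRatioClassFar_eq_pos_of_nonpos le_rfl κ]
  exact nonlocalAtEveryHeight_modulusRatioClassFar 0 hκ

/-! ## §5 The Yoshida band `a ≤ (log 3)/2`: positive bottoms, no deep-negative mode, premise = relative gap -/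

/-- **PROVED (RH-free): `0 < ε₁(ζ(a, N))` for every window with `a ≤ (log 3)/2` and every `N`** — the tree's
strictly regular first rung `0 < ε(a)` (`SpectralTraceWindowStep.weilGroundEnergy_pos_of_le_log_three_half`) pushed up
`ε(a) ≤ ε_ev(a) ≤ ε₁(ζ(a, N))`. [folklore] -/
theorem zeta_bottomRayleigh_pos_of_le_log_three_half (win : Window) (h : win.a ≤ Real.log 3 / 2) :
    0 < bottomRayleigh (zetaDatum win) :=
  ((Summit.RiemannHypothesis.RiemannHypothesis.Theorems.SpectralTraceWindowStep.weilGroundEnergy_pos_of_le_log_three_half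
      win.ha h).trans_le (weilGroundEnergy_le_weilEvenGroundEnergy _)).trans_le
    (weilEvenGroundEnergy_le_bottomRayleigh' win)

/-- **PROVED (RH-free): in the Yoshida band the gauge conjunct at `ζ` IS the relative-gap inequality
`(1 + τ) ε₁ ≤ τ ε₂`.** [folklore] -/
theorem zeta_mem_gaugeRatioAt_iff_of_le_log_three_half {win : Window} (h : win.a ≤ Real.log 3 / 2) (τ : ℝ) :
    zetaDatum ∈ gaugeRatioAt τ win ↔
      (1 + τ) * bottomRayleigh (zetaDatum win) ≤ τ * secondRayleigh (zetaDatum win) := by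
  have hpos := zeta_bottomRayleigh_pos_of_le_log_three_half win h
  show |bottomRayleigh (zetaDatum win)| ≤
      τ * (secondRayleigh (zetaDatum win) - bottomRayleigh (zetaDatum win)) ↔ _
  rw [abs_of_pos hpos]
  have e₁ := mul_sub τ (secondRayleigh (zetaDatum win)) (bottomRayleigh (zetaDatum win))
  have e₂ : (1 + τ) * bottomRayleigh (zetaDatum win) =
      bottomRayleigh (zetaDatum win) + τ * bottomRayleigh (zetaDatum win) := by ring
  constructor <;> intro H <;> linarith

/-- PROVED (RH-free): in the Yoshida band (positive `N`) the modulus conjunct at `ζ` is `ε₁ ≤ κ ε₂`. [folklore] -/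
theorem zeta_mem_modulusRatioAt_iff_of_le_log_three_half {win : Window} (hN : 0 < win.N)
    (h : win.a ≤ Real.log 3 / 2) (κ : ℝ) :
    zetaDatum ∈ modulusRatioAt κ win ↔ bottomRayleigh (zetaDatum win) ≤ κ * secondRayleigh (zetaDatum win) := by
  have hpos := zeta_bottomRayleigh_pos_of_le_log_three_half win h
  have h12 := bottomRayleigh_le_secondRayleigh hN (zetaDatum win)
  show |bottomRayleigh (zetaDatum win)| ≤ κ * |secondRayleigh (zetaDatum win)| ↔ _
  rw [abs_of_pos hpos, abs_of_pos (hpos.trans_le h12)]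

/-- **PROVED (RH-free): NO DEEP-NEGATIVE MODE in the Yoshida band** — rejection of `ζ` by a gauge conjunct at a window
with `a ≤ (log 3)/2` is exactly a SMALL RELATIVE GAP `τ ε₂ < (1 + τ) ε₁` over a positive bottom. [folklore] -/
theorem zeta_not_mem_gaugeRatioAt_iff_of_le_log_three_half {win : Window} (h : win.a ≤ Real.log 3 / 2) (τ : ℝ) :
    zetaDatum ∉ gaugeRatioAt τ win ↔
      τ * secondRayleigh (zetaDatum win) < (1 + τ) * bottomRayleigh (zetaDatum win) := by
  rw [zeta_mem_gaugeRatioAt_iff_of_le_log_three_half h τ, not_le]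

/-- **PROVED (RH-free): the Yoshida-band premise at `ζ` is a RELATIVE-GAP statement** (zero-free: the matrices
involve the archimedean, polar and prime-`2` terms only, `e^{2a} ≤ 3`). [folklore] -/
theorem zeta_mem_gaugeRatioClassBand_log_three_half_iff (amin τ : ℝ) :
    zetaDatum ∈ GaugeRatioClassBand amin (Real.log 3 / 2) τ ↔
      ∀ win : Window, amin ≤ win.a → win.a ≤ Real.log 3 / 2 → 0 < win.N →
        (1 + τ) * bottomRayleigh (zetaDatum win) ≤ τ * secondRayleigh (zetaDatum win) :=
  forall_congr' fun _ => imp_congr_right fun _ =>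
    ⟨fun H h₂ hN => (zeta_mem_gaugeRatioAt_iff_of_le_log_three_half h₂ τ).1 (H h₂ hN),
      fun H h₂ hN => (zeta_mem_gaugeRatioAt_iff_of_le_log_three_half h₂ τ).2 (H h₂ hN)⟩

/-- PROVED (RH-free): the Yoshida-band premise, modulus form. [folklore] -/
theorem zeta_mem_modulusRatioClassBand_log_three_half_iff (amin κ : ℝ) :
    zetaDatum ∈ ModulusRatioClassBand amin (Real.log 3 / 2) κ ↔
      ∀ win : Window, amin ≤ win.a → win.a ≤ Real.log 3 / 2 → 0 < win.N →
        bottomRayleigh (zetaDatum win) ≤ κ * secondRayleigh (zetaDatum win) :=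
  forall_congr' fun _ => imp_congr_right fun _ =>
    ⟨fun H h₂ hN => (zeta_mem_modulusRatioAt_iff_of_le_log_three_half hN h₂ κ).1 (H h₂ hN),
      fun H h₂ hN => (zeta_mem_modulusRatioAt_iff_of_le_log_three_half hN h₂ κ).2 (H h₂ hN)⟩

/-- **PROVED (RH-free): THE YOSHIDA SPLIT of the live premise** — `ζ ∈ GaugeRatioClassFar a_min τ` iff
(band) the relative gap `(1 + τ) ε₁ ≤ τ ε₂` holds at every window of `[a_min, (log 3)/2]` AND (tail) the gauge
conjunct holds at every window with `a > (log 3)/2`. Only the tail can fail by deep negativity. [folklore] -/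
theorem zeta_mem_gaugeRatioClassFar_iff_yoshida_split (amin τ : ℝ) :
    zetaDatum ∈ GaugeRatioClassFar amin τ ↔
      (∀ win : Window, amin ≤ win.a → win.a ≤ Real.log 3 / 2 → 0 < win.N →
        (1 + τ) * bottomRayleigh (zetaDatum win) ≤ τ * secondRayleigh (zetaDatum win)) ∧
      ∀ win : Window, Real.log 3 / 2 < win.a → amin ≤ win.a → 0 < win.N → zetaDatum ∈ gaugeRatioAt τ win := by
  rw [mem_gaugeRatioClassFar_iff_band_and_tail (Real.log 3 / 2), zeta_mem_gaugeRatioClassBand_log_three_half_iff]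

/-- PROVED (RH-free): the Yoshida split, modulus form. [folklore] -/
theorem zeta_mem_modulusRatioClassFar_iff_yoshida_split (amin κ : ℝ) :
    zetaDatum ∈ ModulusRatioClassFar amin κ ↔
      (∀ win : Window, amin ≤ win.a → win.a ≤ Real.log 3 / 2 → 0 < win.N →
        bottomRayleigh (zetaDatum win) ≤ κ * secondRayleigh (zetaDatum win)) ∧
      ∀ win : Window, Real.log 3 / 2 < win.a → amin ≤ win.a → 0 < win.N → zetaDatum ∈ modulusRatioAt κ win := by
  rw [mem_modulusRatioClassFar_iff_band_and_tail (Real.log 3 / 2), zeta_mem_modulusRatioClassBand_log_three_half_iff]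

/-! ## §6 The served window `a = 3/10`: inside the Yoshida band and PRIME-FREE -/

/-- PROVED: `e^{2·(3/10)} < 2` (`3/5 < log 2 = 0.693…`). [folklore] -/
theorem exp_two_mul_three_tenths_lt_two : Real.exp (2 * (3 / 10 : ℝ)) < 2 := by
  have hlog : (2 : ℝ) * (3 / 10) < Real.log 2 := by
    have := Real.log_two_gt_d9
    norm_num at this ⊢
    linarith
  calc Real.exp (2 * (3 / 10)) < Real.exp (Real.log 2) := Real.exp_lt_exp.2 hlog
    _ = 2 := Real.exp_log (by norm_num)

/-- PROVED: `3/10 ≤ (log 3)/2` — the served window lies in the Yoshida band. [folklore] -/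
theorem three_tenths_le_log_three_half : (3 / 10 : ℝ) ≤ Real.log 3 / 2 :=
  le_log_three_half_of_exp_lt_two exp_two_mul_three_tenths_lt_two

/-- PROVED: at a prime-free window (`e^{2a} < 2`) every origin-free table has `ζ`'s block. [folklore] -/
theorem datumOf_apply_eq_zeta_of_exp_lt_two {w : Weights} (hw : w ∈ originFreeWeights) {win : Window}
    (h2 : Real.exp (2 * win.a) < 2) : datumOf w win = zetaDatum win :=
  evenBlock_eq_of_originFree hw zetaWeights_mem_originFreeWeights h2

/-- **PROVED: the served window `a = 3/10` is PRIME-FREE** — for every `N`, `ζ`'s block `ζ ⟨3/10, N⟩` coincides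
with the block of EVERY origin-free table (every dial of `ζ`, every arithmetic twin): it is the archimedean + polar
block and carries no information about the primes. [folklore] -/
theorem datumOf_apply_three_tenths_eq_zeta {w : Weights} (hw : w ∈ originFreeWeights) (N : ℕ) :
    datumOf w ⟨3 / 10, N, by norm_num⟩ = zetaDatum ⟨3 / 10, N, by norm_num⟩ :=
  datumOf_apply_eq_zeta_of_exp_lt_two hw exp_two_mul_three_tenths_lt_two

/-- PROVED (RH-free): `0 < ε₁(ζ(3/10, N))` for every `N`. [folklore] -/
theorem zeta_bottomRayleigh_pos_three_tenths (N : ℕ) :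
    0 < bottomRayleigh (zetaDatum ⟨3 / 10, N, by norm_num⟩) :=
  zeta_bottomRayleigh_pos_of_le_log_three_half _ three_tenths_le_log_three_half

end Summit.RiemannHypothesis.RiemannHypothesis.Theorems.PfPersistence

end
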